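import Mathlib.CategoryTheory.Skeletal
import Literature.AlgebraicGeometry.Frobenioids.NumberFieldLocalizationsMono
import HarnessLib

/-!
# Frobenioids II, Proposition 1.5 (viii), (ix): proofs of the named facts `NFLoc.FSMFFOfFSMType`,
# `NFLoc.TotallyOrderedDescends`

Mochizuki, *The geometry of Frobenioids II: poly-Frobenioids*, Kyushu J. Math. **62** (2008)
401–460, §1, Proposition 1.5 (viii), (ix) p. 14 and their proofs p. 15 [cite: MochizukiFrdII2008,
Prop. 1.5 (viii)(ix) pp.14-15]. The sibling file `NumberFieldLocalizationsMono.lean` (abc-iut-L1-t8) types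
Proposition 1.5 (viii) — "Suppose that `P` is of FSM-type and totally epimorphic. Then
`E = P ×_{P₀} E₀` is of FSMFF-type" — as the named statement `NFLoc.FSMFFOfFSMType F π`, over an
abstract functor `π : E₀ ⥤ P₀` carrying the Example 1.4 (ii) properties the printed proof uses. This
PROOF-ONLY companion discharges it (`NFLoc.FSMFFOfFSMType_holds`) along the printed proof (p. 15):

* a `P₀`-isomorphism of `E₀` is an FSM-morphism (faithfulness of `π` and the reconstruction
  bijection of Example 1.4 (ii) = Prop. 1.5 (i); the printed proof obtains this from (vi) applied to
  the identity functor of `P₀`);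
* "a morphism of `E` is an FSMI-morphism if and only if it is a `P`-isomorphism that projects to an
  FSMI-morphism of `E₀`" (`isFSMI_snd`, `isFSMI_of_isFSMI_snd`), using (vi), "if a composite of two
  morphisms of a totally epimorphic category is an isomorphism then both are" ([FrdI] §0) in `P` and
  in `P₀`, and the lifting of factorisations of the `E₀`-component to `E`;
* hence FSMI-chains of `E` project to FSMI-chains of `E₀` of the same length (condition (b)), and a
  factorisation of the `E₀`-component of a non-invertible FSM-morphism of `E` into FSMI-morphisms
  lifts to `E` (condition (a)): "the fact that `E` is of FSMFF-type follows formally from the fact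
  that `E₀` is of FSMFF-type".

The typed hypothesis list of `FSMFFOfFSMType` suffices as it stands (in particular "`P₀` of
FSM-type" is not needed).

It also discharges the totally ordered clause of Proposition 1.5 (ix) (`NFLoc.TotallyOrderedDescends`,
t8 having PROVED the factorisation and irreducibility clauses): if `φ_E` is a totally ordered
monomorphism then so is `φ_P` — `φ_P` is a monomorphism by (v); `P^↣_{φ_P}` is thin, and any two of
its objects are comparable, by lifting them to `E^↣_{φ_E} ≌ Order(T)` (factorisation clause + (v));
hence `P^↣_{φ_P}` is equivalent to its thin skeleton (Mathlib `ThinSkeleton`), a totally ordered set.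
No new definitions; nothing here is specific to number fields.
-/

namespace Literature.AlgebraicGeometry.Frobenioids

open CategoryTheory

universe v₀ v₁ v₂ u₀ u₁ u₂

namespace NFLoc

section FiberProduct

variable {P₀ : Type u₀} [Category.{v₀} P₀] {E₀ : Type u₁} [Category.{v₁} E₀]
  {P : Type u₂} [Category.{v₂} P] {F : P ⥤ P₀} {π : E₀ ⥤ P₀}

/-! ### Isomorphisms of `E = P ×_{P₀} E₀` -/

/-- A morphism of the categorical fiber product both of whose components are isomorphisms is an
isomorphism. [cite: MochizukiFrdI2008, §0 p.17] -/
theorem isIso_of_isIso_fst_snd {X Y : Loc F π} (φ : X ⟶ Y) [IsIso φ.fst] [IsIso φ.snd] :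
    IsIso φ := by
  have w : F.map (inv φ.fst) ≫ X.iso.hom = Y.iso.hom ≫ π.map (inv φ.snd) := by
    rw [Functor.map_inv, Functor.map_inv, IsIso.inv_comp_eq, ← Category.assoc,
      IsIso.eq_comp_inv, φ.w]
  refine ⟨⟨⟨inv φ.fst, inv φ.snd, w⟩, ?_, ?_⟩⟩
  · exact CFP.hom_ext (by simp) (by simp)
  · exact CFP.hom_ext (by simp) (by simp)

/-- The `P`-component of an isomorphism of `E` is an isomorphism. [cite: MochizukiFrdI2008, §0 p.17] -/
theorem isIso_fst_of_isIso {X Y : Loc F π} (φ : X ⟶ Y) [IsIso φ] : IsIso φ.fst :=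
  (inferInstance : IsIso ((toP F π).map φ))

/-- The `E₀`-component of an isomorphism of `E` is an isomorphism. [cite: MochizukiFrdI2008, §0 p.17] -/
theorem isIso_snd_of_isIso {X Y : Loc F π} (φ : X ⟶ Y) [IsIso φ] : IsIso φ.snd :=
  (inferInstance : IsIso ((toE₀ F π).map φ))

/-- A `P`-isomorphism of `E` projects to a `P₀`-isomorphism of `E₀`
(`π(φ₂) = α_X⁻¹ ≫ F(φ₁) ≫ α_Y`). [cite: MochizukiFrdII2008, Prop. 1.5 (viii) p.15] -/
theorem isIso_map_snd_of_isIso_fst {X Y : Loc F π} (φ : X ⟶ Y) [IsIso φ.fst] :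
    IsIso (π.map φ.snd) := by
  rw [map_snd_eq]
  infer_instance

/-! ### `P₀`-isomorphisms of `E₀` are FSM-morphisms -/

/-- A `P₀`-isomorphism `g` of `E₀` is an FSM-morphism of `E₀`: it is a monomorphism because `π` is
faithful, and fiberwise-surjective because every `γ : Z → X'` is completed to a commutative square by
presenting `π(γ) ≫ π(g)⁻¹` through the reconstruction bijection of Example 1.4 (ii) (the printed
proof, p. 15, invokes Prop. 1.5 (vi) for the identity functor of `P₀`).
[cite: MochizukiFrdII2008, Prop. 1.5 (viii) p.15] -/
theorem isFSM_of_isIso_map [π.Faithful] (h : HomReconstruction π) {X X' : E₀} (g : X ⟶ X')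
    [IsIso (π.map g)] : IsFSM g := by
  refine ⟨fun Z γ => ?_, ⟨fun a b hab => π.map_injective ((cancel_mono (π.map g)).mp ?_)⟩⟩
  · obtain ⟨W, s, f, -, hs⟩ := h.surj Z X (π.map γ ≫ inv (π.map g))
    refine ⟨W, f, s, π.map_injective ?_⟩
    rw [Functor.map_comp, Functor.map_comp, ← hs, Category.assoc, Category.assoc,
      IsIso.inv_hom_id, Category.comp_id]
  · rw [← Functor.map_comp, ← Functor.map_comp, hab]

/-! ### FSMI-morphisms of `E` versus FSMI-morphisms of `E₀` -/

section Hypotheses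

variable [π.Faithful] [π.EssSurj]

/-- "A morphism of `E` is an FSMI-morphism [only if] it is a `P`-isomorphism that projects to an
FSMI-morphism of `E₀`" (FrdII p. 15): the `E₀`-component of an FSMI-morphism of `E` is an
FSMI-morphism (a factorisation of the component lifts to a factorisation in `E`, the `P₀`-components
of its two factors being isomorphisms by the total epimorphicity of `P₀`).
[cite: MochizukiFrdII2008, Prop. 1.5 (viii) p.15] -/
theorem isFSMI_snd (h : HomReconstruction π) (hP₀ : IsTotallyEpimorphic P₀) (hP : IsOfFSMType P)
    {X Y : Loc F π} (φ : X ⟶ Y) (hφ : IsFSMI φ) : IsFSMI φ.snd := by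
  haveI : IsIso φ.fst := (isProjIso_iff_isFSM h hP φ).mpr hφ.1
  haveI := isIso_map_snd_of_isIso_fst φ
  refine ⟨isFSM_of_isIso_map h φ.snd, fun hiso => ?_, fun M x y hxy => ?_⟩
  · haveI := hiso
    exact hφ.2.1 (isIso_of_isIso_fst_snd φ)
  · -- the `P₀`-components of `x`, `y` are isomorphisms
    haveI : IsIso (π.map x ≫ π.map y) := by rw [← Functor.map_comp, hxy]; infer_instance
    obtain ⟨hy, hx⟩ := hP₀.isIso_of_isIso_comp (π.map x) (π.map y)
    -- lift the factorisation to `E`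
    let Mid : Loc F π := CFP.mk X.fst M (X.iso ≪≫ asIso (π.map x))
    let ξ : X ⟶ Mid := ⟨𝟙 _, x, by simp [Mid]⟩
    let η : Mid ⟶ Y := ⟨φ.fst, y, by
      simp only [Mid, Iso.trans_hom, asIso_hom, Category.assoc, ← Functor.map_comp, hxy]
      exact φ.w⟩
    have hfac : ξ ≫ η = φ := CFP.hom_ext (Category.id_comp _) hxy
    rcases hφ.2.2 ξ η hfac with hη | hξ
    · exact Or.inl (isIso_snd_of_isIso η)
    · exact Or.inr (isIso_snd_of_isIso ξ)

/-- FSMI-chains of `E` project to FSMI-chains of `E₀` of the same length.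
[cite: MochizukiFrdII2008, Prop. 1.5 (viii) p.15] -/
theorem isFSMIChain_snd (h : HomReconstruction π) (hP₀ : IsTotallyEpimorphic P₀)
    (hP : IsOfFSMType P) {X Y : Loc F π} {φ : X ⟶ Y} {n : ℕ} (hφ : IsFSMIChain φ n) :
    IsFSMIChain φ.snd n := by
  induction hφ with
  | single φ hφ => exact IsFSMIChain.single _ (isFSMI_snd h hP₀ hP φ hφ)
  | cons ψ χ n hψ _ ih => exact IsFSMIChain.cons ψ.snd χ.snd n (isFSMI_snd h hP₀ hP ψ hψ) ih

/-- "… [if] it is a `P`-isomorphism that projects to an FSMI-morphism of `E₀`" (FrdII p. 15): a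
`P`-isomorphism of `E` whose `E₀`-component is an FSMI-morphism is an FSMI-morphism (a factorisation
in `E` projects to factorisations in `E₀` and in `P`; the `P`-components of both factors are
isomorphisms by the total epimorphicity of `P`). [cite: MochizukiFrdII2008, Prop. 1.5 (viii) p.15] -/
theorem isFSMI_of_isFSMI_snd (h : HomReconstruction π) (hP : IsOfFSMType P)
    (hPt : IsTotallyEpimorphic P) {X Y : Loc F π} (φ : X ⟶ Y) [IsIso φ.fst]
    (hφ : IsFSMI φ.snd) : IsFSMI φ := by
  refine ⟨(isProjIso_iff_isFSM h hP φ).mp (inferInstance : IsIso φ.fst), fun hiso => ?_,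
    fun Mid ξ η hfac => ?_⟩
  · haveI := hiso
    exact hφ.2.1 (isIso_snd_of_isIso φ)
  · haveI : IsIso (ξ.fst ≫ η.fst) := by
      rw [← CFP.comp_fst, hfac]
      infer_instance
    obtain ⟨hη, hξ⟩ := hPt.isIso_of_isIso_comp ξ.fst η.fst
    rcases hφ.2.2 ξ.snd η.snd (by rw [← CFP.comp_snd, hfac]) with hη' | hξ'
    · exact Or.inl (isIso_of_isIso_fst_snd η)
    · exact Or.inr (isIso_of_isIso_fst_snd ξ)

/-- Lifting FSMI-chains: an FSMI-chain `X → ⋯ → Y` of `E₀` lying under a `P`-isomorphism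
`(f, g) : (a, X, α) → (b, Y, β)` of `E` lifts to an FSMI-chain of `E` of the same length with
composite `(f, g)` (intermediate objects `(a, Xᵢ, α ≫ π(g₁ ⋯ gᵢ))`, the `π(gᵢ)` being isomorphisms by
the total epimorphicity of `P₀`). [cite: MochizukiFrdII2008, Prop. 1.5 (viii) p.15] -/
theorem isFSMIChain_of_isFSMIChain_snd (h : HomReconstruction π) (hP₀ : IsTotallyEpimorphic P₀)
    (hP : IsOfFSMType P) (hPt : IsTotallyEpimorphic P) :
    ∀ {X Y : E₀} {g : X ⟶ Y} {n : ℕ}, IsFSMIChain g n →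
      ∀ {a b : P} (f : a ⟶ b) [IsIso f] (α : F.obj a ≅ π.obj X) (β : F.obj b ≅ π.obj Y)
        (w : F.map f ≫ β.hom = α.hom ≫ π.map g),
        IsFSMIChain (show CFP.mk a X α ⟶ CFP.mk b Y β from ⟨f, g, w⟩) n := by
  intro X Y g n hg
  induction hg with
  | single g hg =>
    intro a b f _ α β w
    exact IsFSMIChain.single _
      (isFSMI_of_isFSMI_snd h hP hPt (show CFP.mk a _ α ⟶ CFP.mk b _ β from ⟨f, g, w⟩) hg)
  | cons ψ χ n hψ _ ih =>
    intro a b f _ α β w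
    -- `π(ψ)` and `π(χ)` are isomorphisms (total epimorphicity of `P₀`)
    haveI : IsIso (π.map ψ ≫ π.map χ) := by
      have hi := isIso_map_snd_of_isIso_fst (show CFP.mk a _ α ⟶ CFP.mk b _ β from ⟨f, ψ ≫ χ, w⟩)
      rw [← Functor.map_comp]
      exact hi
    obtain ⟨_, hψiso⟩ := hP₀.isIso_of_isIso_comp (π.map ψ) (π.map χ)
    have w₁ : F.map (𝟙 a) ≫ (α ≪≫ asIso (π.map ψ)).hom = α.hom ≫ π.map ψ := by simp
    have w₂ : F.map f ≫ β.hom = (α ≪≫ asIso (π.map ψ)).hom ≫ π.map χ := by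
      simp only [Iso.trans_hom, asIso_hom, Category.assoc, ← Functor.map_comp]
      exact w
    have hξ : IsFSMI (show CFP.mk a _ α ⟶ CFP.mk a _ (α ≪≫ asIso (π.map ψ)) from ⟨𝟙 a, ψ, w₁⟩) :=
      isFSMI_of_isFSMI_snd h hP hPt
        (show CFP.mk a _ α ⟶ CFP.mk a _ (α ≪≫ asIso (π.map ψ)) from ⟨𝟙 a, ψ, w₁⟩) hψ
    have hc := IsFSMIChain.cons _ _ n hξ (ih f (α ≪≫ asIso (π.map ψ)) β w₂)
    have heq : (show CFP.mk a _ α ⟶ CFP.mk a _ (α ≪≫ asIso (π.map ψ)) from ⟨𝟙 a, ψ, w₁⟩) ≫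
        (show CFP.mk a _ (α ≪≫ asIso (π.map ψ)) ⟶ CFP.mk b _ β from ⟨f, χ, w₂⟩) =
        (show CFP.mk a _ α ⟶ CFP.mk b _ β from ⟨f, ψ ≫ χ, w⟩) :=
      CFP.hom_ext (Category.id_comp f) rfl
    rw [heq] at hc
    exact hc

end Hypotheses

/-! ### Proposition 1.5 (viii) -/

variable (F π) in
/-- **Proposition 1.5 (viii)** (FrdII p. 14), DISCHARGED: if `P` is of FSM-type and totally
epimorphic then `E = P ×_{P₀} E₀` is of FSMFF-type (under the Example 1.4 (ii) properties of
`E₀ → P₀` listed in the named statement `NFLoc.FSMFFOfFSMType`): "the fact that `E` is of FSMFF-type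
follows formally from the fact that `E₀` is of FSMFF-type" (p. 15).
[cite: MochizukiFrdII2008, Prop. 1.5 (viii) p.14] -/
theorem FSMFFOfFSMType_holds : FSMFFOfFSMType F π := by
  intro _ _ h hP₀ hE₀ hP hPt
  refine ⟨fun {X Y} φ hφ hniso => ?_, fun X => ?_⟩
  · -- (a): factor the `E₀`-component and lift the chain
    haveI : IsIso φ.fst := (isProjIso_iff_isFSM h hP φ).mpr hφ
    haveI := isIso_map_snd_of_isIso_fst φ
    have hg : IsFSM φ.snd := isFSM_of_isIso_map h φ.snd
    have hgiso : ¬ IsIso φ.snd := fun hiso => by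
      haveI := hiso
      exact hniso (isIso_of_isIso_fst_snd φ)
    obtain ⟨n, hn⟩ := hE₀.factors φ.snd hg hgiso
    exact ⟨n, isFSMIChain_of_isFSMIChain_snd h hP₀ hP hPt hn φ.fst X.iso Y.iso φ.w⟩
  · -- (b): chains out of `X` project to chains out of `X.snd`
    obtain ⟨N, hN⟩ := hE₀.bounded X.snd
    exact ⟨N, fun φ n hφ => hN φ.snd n (isFSMIChain_snd h hP₀ hP hφ)⟩

/-! ### Proposition 1.5 (ix), the totally ordered clause -/

section TotallyOrdered

/-- The category `C^↣_ψ` of factorisations of a morphism `ψ` through monomorphisms is thin: a morphism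
of factorisations is determined by its compatibility with the second (monic) arrows.
[cite: MochizukiFrdII2008, §0 p.6] -/
theorem subsingleton_hom_monoFactorisations {C : Type u₂} [Category.{v₂} C] {A B : C} {ψ : A ⟶ B}
    (G₁ G₂ : MonoFactorisations ψ) : Subsingleton (G₁ ⟶ G₂) := by
  refine ⟨fun a b => ObjectProperty.hom_ext _ (Factorisation.Hom.ext ?_)⟩
  haveI : Mono G₂.obj.π := (show Mono G₂.obj.ι ∧ Mono G₂.obj.π from G₂.property).2
  exact (cancel_mono G₂.obj.π).mp (by rw [a.hom.h_π, b.hom.h_π])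

/-- Comparison of two mono-factorisations `G`, `G'` of `φ_P` from a morphism between lifts of them to
mono-factorisations of `φ_E` (FrdII p. 15: the totally ordered clause "follows from the portion of
assertion (ix) concerning factorizations, together with … (v)").
[cite: MochizukiFrdII2008, Prop. 1.5 (ix) p.15] -/
theorem nonempty_hom_monoFactorisations_of_lift {X Y : Loc F π} {φ : X ⟶ Y}
    (G G' : MonoFactorisations φ.fst) {X₂ X₂' : E₀} {γ : F.obj G.obj.mid ≅ π.obj X₂}
    {γ' : F.obj G'.obj.mid ≅ π.obj X₂'} {β : X ⟶ CFP.mk G.obj.mid X₂ γ}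
    {α' : CFP.mk G'.obj.mid X₂' γ' ⟶ Y} {β' : X ⟶ CFP.mk G'.obj.mid X₂' γ'}
    {α : CFP.mk G.obj.mid X₂ γ ⟶ Y} (hβ : β.fst = G.obj.ι) (hα : α.fst = G.obj.π)
    (hβ' : β'.fst = G'.obj.ι) (hα' : α'.fst = G'.obj.π)
    (κ : CFP.mk G.obj.mid X₂ γ ⟶ CFP.mk G'.obj.mid X₂' γ') (hι : β ≫ κ = β') (hπ : κ ≫ α' = α) :
    Nonempty (G ⟶ G') := by
  refine ⟨ObjectProperty.homMk ⟨κ.fst, ?_, ?_⟩⟩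
  · have e := congrArg CFP.Hom.fst hι
    rw [CFP.comp_fst, hβ, hβ'] at e
    exact e
  · have e := congrArg CFP.Hom.fst hπ
    rw [CFP.comp_fst, hα, hα'] at e
    exact e

/-- Any two mono-factorisations of the projection `φ_P` of a totally ordered monomorphism `φ_E` of
`E` are comparable (under the hypothesis on `D_v`): lift both to mono-factorisations of `φ_E`
(the factorisation clause of (ix) and the monomorphism clause of (v)) and compare them in the totally
ordered category `E^↣_{φ_E}`. [cite: MochizukiFrdII2008, Prop. 1.5 (ix) p.15] -/
theorem monoFactorisations_fst_total [π.Faithful] [π.EssSurj] (hP₀ : HasTrivialFactorizations P₀)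
    (h : HomReconstruction π) {X Y : Loc F π} (φ : X ⟶ Y) (hφ : IsTotallyOrderedHom φ)
    (G₁ G₂ : MonoFactorisations φ.fst) :
    Nonempty (G₁ ⟶ G₂) ∨ Nonempty (G₂ ⟶ G₁) := by
  obtain ⟨-, T, instT, ⟨e⟩⟩ := hφ
  -- lift the two factorisations to `E`
  obtain ⟨X₁, γ₁, β₁, α₁, hc₁, hβ₁, hα₁⟩ :=
    exists_lift_factorization hP₀ φ G₁.obj.ι G₁.obj.π G₁.obj.ι_π
  obtain ⟨X₂, γ₂, β₂, α₂, hc₂, hβ₂, hα₂⟩ :=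
    exists_lift_factorization hP₀ φ G₂.obj.ι G₂.obj.π G₂.obj.ι_π
  have hG₁ : Mono G₁.obj.ι ∧ Mono G₁.obj.π := G₁.property
  have hG₂ : Mono G₂.obj.ι ∧ Mono G₂.obj.π := G₂.property
  have hmβ₁ : Mono β₁ := (mono_iff_fst h β₁).mpr (by rw [hβ₁]; exact hG₁.1)
  have hmα₁ : Mono α₁ := (mono_iff_fst h α₁).mpr (by rw [hα₁]; exact hG₁.2)
  have hmβ₂ : Mono β₂ := (mono_iff_fst h β₂).mpr (by rw [hβ₂]; exact hG₂.1)
  have hmα₂ : Mono α₂ := (mono_iff_fst h α₂).mpr (by rw [hα₂]; exact hG₂.2)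
  let L₁ : MonoFactorisations φ := ⟨⟨CFP.mk G₁.obj.mid X₁ γ₁, β₁, α₁, hc₁⟩, hmβ₁, hmα₁⟩
  let L₂ : MonoFactorisations φ := ⟨⟨CFP.mk G₂.obj.mid X₂ γ₂, β₂, α₂, hc₂⟩, hmβ₂, hmα₂⟩
  -- compare the lifts in the totally ordered category `E^↣_φ ≌ Order(T)`
  rcases le_total (e.functor.obj L₁) (e.functor.obj L₂) with hle | hle
  · have κ : L₁ ⟶ L₂ := e.unit.app L₁ ≫ e.inverse.map hle.hom ≫ e.unitInv.app L₂
    exact Or.inl (nonempty_hom_monoFactorisations_of_lift G₁ G₂ hβ₁ hα₁ hβ₂ hα₂ κ.hom.h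
      κ.hom.ι_h κ.hom.h_π)
  · have κ : L₂ ⟶ L₁ := e.unit.app L₂ ≫ e.inverse.map hle.hom ≫ e.unitInv.app L₁
    exact Or.inr (nonempty_hom_monoFactorisations_of_lift G₂ G₁ hβ₂ hα₂ hβ₁ hα₁ κ.hom.h
      κ.hom.ι_h κ.hom.h_π)

variable (F π) in
/-- **Proposition 1.5 (ix)**, totally ordered clause (FrdII p. 14), DISCHARGED: under the hypothesis
on `D_v` (one factor of every composite in `P₀` is an isomorphism), if `φ_E` is a totally ordered
monomorphism of `E` then its projection `φ_P` is a totally ordered monomorphism of `P`: `φ_P` is a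
monomorphism by (v), the category `P^↣_{φ_P}` is thin, and any two of its objects are comparable
(`monoFactorisations_fst_total`), so it is equivalent to its thin skeleton, a totally ordered set.
[cite: MochizukiFrdII2008, Prop. 1.5 (ix) p.14] -/
theorem TotallyOrderedDescends_holds : TotallyOrderedDescends F π := by
  intro hP₀ _ _ h X Y φ hφ
  refine ⟨(mono_iff_fst h φ).mp hφ.1, ?_⟩
  haveI hthin : Quiver.IsThin (MonoFactorisations φ.fst) := subsingleton_hom_monoFactorisations
  letI instLO : LinearOrder (ThinSkeleton (MonoFactorisations φ.fst)) :=
    { (inferInstance : PartialOrder (ThinSkeleton (MonoFactorisations φ.fst))) with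
      le_total := fun x y => Quotient.inductionOn₂ x y fun G₁ G₂ =>
        monoFactorisations_fst_total hP₀ h φ hφ G₁ G₂
      toDecidableLE := Classical.decRel _ }
  exact ⟨ThinSkeleton (MonoFactorisations φ.fst), instLO,
    ⟨(ThinSkeleton.equivalence (MonoFactorisations φ.fst)).symm⟩⟩

end TotallyOrdered

end FiberProduct

end NFLoc

end Literature.AlgebraicGeometry.Frobenioids
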